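import Literature.AnabelianGeometry.SemiGraphs.TemperedSpecialFibreTowerVertexAction
import Literature.AnabelianGeometry.SemiGraphs.TemperedSpecialFibreDataVertexAction
import Literature.AnabelianGeometry.SemiGraphs.TemperedCurveBridge
import HarnessLib

/-!
# The special-fibre tower's Π-equivariant structure: the successor record `SpecialFibreTower.PiData`
# ([SemiAnbd] Ex. 3.10 pp. 44–45; [IUTchI] §2 pp. 44–50) — INTERFACE (origin data)

Mochizuki, *Semi-graphs of anabelioids*, Publ. RIMS **42** (2006), §3, Example 3.10, manuscript p. 44
[cite: MochizukiSemiAnbd2006, Ex 3.10 p.44] ("an exhaustive sequence of open characteristic … subgroups … `N_i` …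
semi-graphs of anabelioids `𝒢_i`, `𝒢^c_i` on which `Δ_i` acts faithfully … natural morphisms of temperoids
`… → B^temp(𝒢_i) → … → B^temp(𝒢)` compatible with the actions of the `Δ_i`"; Def. 2.11 generalized morphisms);
S. Mochizuki, *Inter-universal Teichmüller theory I*, §2, p. 44 ("a [connected] sub-semi-graph `ℍ ⊆ 𝔾` …
`Π^tp_ℍ ⊆ Π^tp_𝔾` … the decomposition subgroup, well-defined up to conjugation"), Cor. 2.3 (vi) p. 48 (cusp ↔
component incidence), proof of Prop. 2.4 (i) p. 50 l. 27–30 (`X_J → X_K` Galois; `𝔾_J`)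
[cite: Mochizuki2012, Prop 2.4(i) p.50].

abc-iut cell, seat abc-iut-L3-t2 gen 3, GAP-LEDGER row **G-w4d063-1 part (b)** (L3-lead gen 5 α25 (6) / α26 (1); SHAPES
`HOME/staging/L3/L3-t2/SHAPES-G-w4d063-1.md`; filed in the director's DEF window).  The structures
`SpecialFibreData` (seat abc-iut-L3-t2) and `SpecialFibreTower` (seat abc-iut-w5-d122) record groups and charts only;
the items consumers of [IUTchI] §2 need at the GENUINE 𝔛-datum and which are NOT derivable are collected here as
ORIGIN DATA (policy D — nothing is asserted for any curve):
* `SpecialFibreTower.FiniteLevels S T` (small `Prop` record): the dual semi-graphs of the special fibres of a stable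
  curve and of its finite étale coverings are FINITE (custody note t2g3-C2; consumers needing only Thm. 3.7 (iii)/(iv)
  at the fibres bind this one);
* `SpecialFibreTower.PiData X d S T` with fields (P0) `admKer_normal_pi` / `admissibleKer_normal_pi` (the admissible
  kernels are normal in `Π^temp_{X_K}`: `X_{N_i} → X_K` is Galois — exactly the binders `hP0` / `hK0` of the
  vertex-action files, where (P1) `actVertex` is DERIVED), `N_cofinal` (the COFINAL reading of "exhaustive",
  seat abc-iut-L5-t11's `hcof`), `finite`, (P2) the actions `actGraph i` / `actGraph₀` of `Π` on the semi-graphs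
  `𝔾^c_i` / `𝔾^c` by automorphisms WHOSE VERTEX PARTS ARE THE DERIVED `actVertex` (laws `actGraph_vertexMap`), the
  projections `proj i : 𝔾^c_i ⟶ 𝔾^c` with their `Π`-equivariance `proj_actGraph`, the sub-semi-graph `H` with its
  decomposition group `TpH` and laws, a base vertex with lifts, and (P3) the cusp incidence `vtxOfCusp` with
  `inertia_le_verticial`.
HONEST LIMITS: every field is a statement about THE special-fibre tower of a curve; `X.Pt` carries no `Π`-action, so
cusp equivariance is expressed through inertia groups only; a `_model` inhabitant exists only where a genuine tower
does (the §4(iii) witnesses of this lane are curve-free).  No instance, no notation, no `Prop` fact beyond the record's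
own fields; nothing here bears on [IUTchIII] Cor. 3.12.
-/

noncomputable section

namespace Literature.AnabelianGeometry.SemiGraphs

open ProfiniteSemiGraph Topology CategoryTheory
open scoped Pointwise

/-- `Δ^temp_X = Ker(Π^temp_{X_K} → G_{ℚ_p})` is normal (a kernel). [cite: MochizukiSemiAnbd2006, §6 p.69] -/
theorem TemperedCurve.normal_deltaTemp {p : ℕ} [Fact p.Prime] (X : TemperedCurve p) : X.DeltaTemp.Normal := by
  unfold TemperedCurve.DeltaTemp; infer_instance

namespace SpecialFibreTower

variable {p : ℕ} [Fact p.Prime] (X : TemperedCurve p) (d : X.GroupLevelData)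
  (S : SpecialFibreData (X.toTemperedArithmeticGroup d)) (T : SpecialFibreTower X.DeltaTemp)

/-- **Finiteness of the dual semi-graphs** of the special fibres (base `𝒢^c` and levels `𝒢^c_i`): the dual graph of a
pointed stable curve has finitely many vertices (irreducible components) and edges (nodes and cusps).  A small `Prop`
record of its own so that consumers needing only Thm. 3.7 (iii)/(iv) at the fibres bind just this (no instances are
declared; use `haveI := F.finite_vertex i`). [cite: MochizukiSemiAnbd2006, Ex 3.10 p.44] -/
structure FiniteLevels : Prop where
  /-- the base special fibre `𝒢^c` has finitely many vertices -/
  finite_vertex_base : Finite S.Gc.graph.Vertex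
  /-- … and finitely many edges -/
  finite_edge_base : Finite S.Gc.graph.Edge
  /-- every level `𝒢^c_i` has finitely many vertices -/
  finite_vertex : ∀ i, Finite (T.Gc i).graph.Vertex
  /-- … and finitely many edges -/
  finite_edge : ∀ i, Finite (T.Gc i).graph.Edge

/-- **`SpecialFibreTower.PiData` — the `Π`-equivariant structure of the special-fibre tower at the genuine 𝔛-datum**
(GAP-LEDGER G-w4d063-1 (b); [SemiAnbd] Ex. 3.10 p. 44, [IUTchI] §2 pp. 44–50), ORIGIN DATA over
`S : SpecialFibreData` (base fibre `𝒢^c`, `Δ ↠ π₁^temp(𝒢^c)`) and `T : SpecialFibreTower Δ^temp_X` (levels `N_i`,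
fibres `𝒢^c_i`, `N_i ↠ π₁^temp(𝒢^c_i)`).  Item (P1) (the vertex actions) is NOT a field: it is DERIVED from (P0) in
`TemperedSpecialFibreTowerVertexAction.lean` / `TemperedSpecialFibreDataVertexAction.lean` and enters the laws below
through `SpecialFibreTower.actVertex` / `SpecialFibreData.actVertex` (with the Thm. 3.7 (iv) binder `hiv`,
a theorem at the finite fibres).  Nothing asserts such data exists for a given curve.
[cite: Mochizuki2012, Prop 2.4(i) p.50] -/
structure PiData : Type 1 where
  /-- **(P0)** "the admissible kernels `Ker(N_i ↠ π₁^temp(𝒢^c_i))` are normal in `Π^temp_{X_K}`" (not only in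
  `Δ^temp_X`: `X_{N_i} → X_K` is Galois with group `Π/N_i` and the admissible coverings of its special fibre are
  intrinsic, [IUTchI] p. 50 l. 27–30) — the binder `hP0` of `SpecialFibreTower.actVertex`. -/
  admKer_normal_pi : ∀ i, ((T.admKer i).map X.DeltaTemp.subtype).Normal
  /-- **(P0)₀** the same for the base fibre: `Ker(Δ ↠ π₁^temp(𝒢^c))` is normal in `Π^temp_{X_K}` — the binder `hK0` of
  `SpecialFibreData.actVertex` ([SemiAnbd] p. 44: "the natural full embedding `B^temp(𝒢) ↪ B^temp(Δ)`" is intrinsic). -/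
  admissibleKer_normal_pi :
    (S.admissible.toMonoidHom.ker.map (X.toTemperedArithmeticGroup d).delta.subtype).Normal
  /-- **cofinality** — the COFINAL reading of "an exhaustive sequence … `⊆ N_i ⊆ … ⊆ Δ`" (p. 44 l. 9): every open
  normal subgroup of finite index of `Δ^temp_X` contains some `N_i` (seat abc-iut-L5-t11's binder `hcof`;
  `T.N_exhaustive : ⋂ N_i = 1` is weaker). -/
  N_cofinal : ∀ U : Subgroup X.DeltaTemp, IsOpen (U : Set X.DeltaTemp) → U.Normal → U.FiniteIndex →
    ∃ i, T.N i ≤ U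
  /-- the dual semi-graphs are finite (see `FiniteLevels`) -/
  finite : FiniteLevels X d S T
  /-- **(P2) the action of `Π` on the semi-graph `𝔾^c_i` by automorphisms** ("semi-graphs of anabelioids `𝒢_i`,
  `𝒢^c_i` on which `Δ_i` acts", p. 44 l. 14; through `Π/N_i`), as DATA in the category of semi-graphs — its VERTEX part
  is not free: it must agree with the derived `SpecialFibreTower.actVertex` (law `actGraph_vertexMap`); the edge part
  on OPEN edges (cusps) is invisible to `π₁^temp` (Rmk. 3.9.1) and is genuinely a datum. -/
  actGraph : ∀ i, X.PiTemp →* CategoryTheory.Aut (T.Gc i).graph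
  /-- the same on the base fibre `𝔾^c` ("the natural action of `G_k` on `𝔾`", [IUTchI] p. 47) -/
  actGraph₀ : X.PiTemp →* CategoryTheory.Aut S.Gc.graph
  /-- the vertex part of `actGraph i g` IS the derived vertex action (any Thm. 3.7 (iv) witness `hiv`) -/
  actGraph_vertexMap : ∀ (i : ℕ) (hiv : MaximalCompactIffVerticialAt (T.Gc i)) (g : X.PiTemp)
    (v : (T.Gc i).graph.Vertex),
    (actGraph i g).hom.vertexMap v = T.actVertex (hΔ := X.normal_deltaTemp) admKer_normal_pi i hiv g v
  /-- the vertex part of `actGraph₀ g` IS the derived base vertex action -/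
  actGraph₀_vertexMap : ∀ (hiv₀ : MaximalCompactIffVerticialAt S.Gc) (g : X.PiTemp) (v : S.Gc.graph.Vertex),
    (actGraph₀ g).hom.vertexMap v = S.actVertex admissibleKer_normal_pi hiv₀ g v
  /-- **(P2) projections** `𝔾^c_i ⟶ 𝔾^c` — the underlying-semi-graph part of the "generalized morphisms
  `𝒢_i → 𝒢`" of p. 44 l. 18–36 (Def. 2.11), from the special fibre of `X_{N_i}` to that of `X`. -/
  proj : ∀ i, ((T.Gc i).graph ⟶ S.Gc.graph)
  /-- the projections are surjective on vertices (every component of the special fibre of `X` is dominated) -/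
  proj_vertex_surjective : ∀ i, Function.Surjective (proj i).vertexMap
  /-- **(P2) equivariance**: the projections commute with the `Π`-actions on the semi-graphs ("compatible with the
  actions", p. 45 l. 1). -/
  proj_actGraph : ∀ (i : ℕ) (g : X.PiTemp), (actGraph i g).hom ≫ proj i = proj i ≫ (actGraph₀ g).hom
  /-- **(P2) the sub-semi-graph `ℍ ⊆ 𝔾`** ([IUTchI] §2 p. 44: "a [connected] sub-semi-graph"). -/
  H : S.Gc.graph.Subgraph
  /-- `ℍ` is connected -/
  H_connected : H.toSemiGraph.IsConnected
  /-- `ℍ` is `Π`-stable ("stabilized by the natural action of `G_k` on `𝔾`", p. 47): vertices and edges -/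
  H_stable : ∀ (g : X.PiTemp), (∀ v ∈ H.verts, (actGraph₀ g).hom.vertexMap v ∈ H.verts) ∧
    ∀ e ∈ H.edges, (actGraph₀ g).hom.edgeMap e ∈ H.edges
  /-- **`Π^tp_ℍ ∩ π₁^temp(𝒢^c)`-avatar**: the decomposition group of `ℍ` in `π₁^temp(𝒢^c)` ("`Π^tp_ℍ ⊆ Π^tp_𝔾` … the
  decomposition subgroup, well-defined up to conjugation", p. 45 l. 4–8), one representative. -/
  TpH : Subgroup S.chart.G
  /-- it contains a verticial subgroup of every vertex of `ℍ` -/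
  TpH_verticial : ∀ v ∈ H.verts, ∃ K ∈ verticialSubgroups S.chart v, K ≤ TpH
  /-- it is generated by those (the image of `π₁^temp(𝒢^c|_ℍ)`): contained in the closed subgroup they generate -/
  TpH_le : TpH ≤ (Subgroup.closure (⋃ v ∈ H.verts, ⋃ K ∈ verticialSubgroups S.chart v, (K : Set S.chart.G))).topologicalClosure
  /-- **a base component over `ℍ`**: a compatible choice of a vertex of `𝔾^c_i` over a fixed vertex of `ℍ` (singling out
  the component `ℍ̃_i` of `proj i ⁻¹(ℍ)` whose stabiliser is `Δ^tp_{X,ℍ}·N_i`, [IUTchI] p. 45) -/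
  baseVertex : S.Gc.graph.Vertex
  /-- it lies in `ℍ` -/
  baseVertex_mem : baseVertex ∈ H.verts
  /-- its chosen lifts -/
  baseLift : ∀ i, (T.Gc i).graph.Vertex
  /-- … are lifts -/
  proj_baseLift : ∀ i, (proj i).vertexMap (baseLift i) = baseVertex
  /-- **(P3) cusp incidence**: the vertex of `𝔾^c_i` met by the level-`i` cusp lying under the pro-cusp of the cusp
  `x` fixed by the representative inertia group `I_x` (Cor. 2.3 (vi) p. 48) -/
  vtxOfCusp : ∀ i, {x : X.Pt // X.IsCusp x} → (T.Gc i).graph.Vertex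
  /-- the cusp incidences are compatible with the projections -/
  proj_vtxOfCusp : ∀ i j (x : {x : X.Pt // X.IsCusp x}),
    (proj i).vertexMap (vtxOfCusp i x) = (proj j).vertexMap (vtxOfCusp j x)
  /-- **(P3) law**: the inertia group `I_x ∩ N_i` of the cusp lies, through the admissible quotient, in a verticial
  subgroup of the vertex it meets ("`ξ` meets an irreducible component", Cor. 2.3 (vi) p. 48) -/
  inertia_le_verticial : ∀ i (x : {x : X.Pt // X.IsCusp x}),
    ∃ K ∈ verticialSubgroups (T.chart i) (vtxOfCusp i x),
      (((X.inertia x.1).subgroupOf X.DeltaTemp).subgroupOf (T.N i)).map (T.adm i).toMonoidHom ≤ K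

namespace PiData

variable {X d S T} (P : PiData X d S T)

/-- **(P2) defined, not posited**: the connected components of `proj i ⁻¹(ℍ)` — as the vertex sets of the connected
components of the sub-semi-graph of `𝔾^c_i` lying over `ℍ` (seat abc-iut-L5-t11's `comps i`).
[cite: Mochizuki2012, Cor 2.3(vi) p.48] -/
def preimageH (i : ℕ) : (T.Gc i).graph.Subgraph where
  verts := {v | (P.proj i).vertexMap v ∈ P.H.verts}
  edges := {e | (P.proj i).edgeMap e ∈ P.H.edges}

/-- The base lift lies over `ℍ`. [cite: Mochizuki2012, Cor 2.3(vi) p.48] -/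
theorem baseLift_mem_preimageH (i : ℕ) : P.baseLift i ∈ (P.preimageH i).verts := by
  show (P.proj i).vertexMap (P.baseLift i) ∈ P.H.verts
  rw [P.proj_baseLift]; exact P.baseVertex_mem

/-- **Equivariance on vertices** (derived): `proj i (g · v) = g · proj i v` for the DERIVED vertex actions.
[cite: Mochizuki2012, Prop 2.4(i) p.50] -/
theorem proj_actVertex (i : ℕ) (hiv : MaximalCompactIffVerticialAt (T.Gc i))
    (hiv₀ : MaximalCompactIffVerticialAt S.Gc) (g : X.PiTemp) (v : (T.Gc i).graph.Vertex) :
    (P.proj i).vertexMap (T.actVertex (hΔ := X.normal_deltaTemp) P.admKer_normal_pi i hiv g v) =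
      S.actVertex P.admissibleKer_normal_pi hiv₀ g ((P.proj i).vertexMap v) := by
  rw [← P.actGraph_vertexMap i hiv g v, ← P.actGraph₀_vertexMap hiv₀ g]
  have h := congrArg (fun F => SemiGraph.Hom.vertexMap F v) (P.proj_actGraph i g)
  exact h

/-- `proj i ⁻¹(ℍ)` is `Π`-stable on vertices (equivariance + stability of `ℍ`). [cite: Mochizuki2012, Cor 2.3 p.47] -/
theorem actVertex_mem_preimageH (i : ℕ) (hiv : MaximalCompactIffVerticialAt (T.Gc i))
    (hiv₀ : MaximalCompactIffVerticialAt S.Gc) (g : X.PiTemp) {v : (T.Gc i).graph.Vertex}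
    (hv : v ∈ (P.preimageH i).verts) :
    T.actVertex (hΔ := X.normal_deltaTemp) P.admKer_normal_pi i hiv g v ∈ (P.preimageH i).verts := by
  show (P.proj i).vertexMap _ ∈ P.H.verts
  rw [P.proj_actVertex i hiv hiv₀, ← P.actGraph₀_vertexMap hiv₀]
  exact (P.H_stable g).1 _ hv

/-- `proj i ⁻¹(ℍ)` is `Π`-stable on edges. [cite: Mochizuki2012, Cor 2.3 p.47] -/
theorem actGraph_edge_mem_preimageH (i : ℕ) (g : X.PiTemp) {e : (T.Gc i).graph.Edge}
    (he : e ∈ (P.preimageH i).edges) : (P.actGraph i g).hom.edgeMap e ∈ (P.preimageH i).edges := by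
  show (P.proj i).edgeMap _ ∈ P.H.edges
  have h := congrArg (fun F => SemiGraph.Hom.edgeMap F e) (P.proj_actGraph i g)
  simp only [SemiGraph.comp_edgeMap, Function.comp_apply] at h
  rw [h]
  exact (P.H_stable g).2 _ he

end PiData

end SpecialFibreTower

end Literature.AnabelianGeometry.SemiGraphs

end
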